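import Literature.AlgebraicGeometry.Frobenioids.Thm49Arithmetic
import Literature.AlgebraicGeometry.Frobenioids.Thm49Padic
import Literature.AlgebraicGeometry.Frobenioids.DivisorMonoidRightEqLeftLocal
import Literature.AlgebraicGeometry.Frobenioids.DivisorMonoidCategoryTheoreticityThm42
import HarnessLib

/-!
# Frobenioids I, Theorem 4.9, the slot "the right-hand and left-hand isomorphisms of Theorem 4.2 (iii)
# coincide" (`FrdI.T49.RightEqLeftAt`) at THE `Ψ^Prime`-corresponding primes — for every pair of Frobenioids
# over bases of FSM-type, and HYPOTHESIS-FREE at the genuine carriers `C_{K/F}` and `C₀(p)`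

Mochizuki, *The geometry of Frobenioids I: the general theory*, Kyushu J. Math. **62** (2008) 293–400, §4,
Theorem 4.9, proof p. 89 ll. 6–9 [cite: MochizukiFrdI2008, Thm. 4.9 p.89]: "it suffices to show that the right-hand
and left-hand isomorphisms of Theorem 4.2, (iii), coincide [i.e., when `A` is Div-Frobenius-trivial]"; the
carriers: the arithmetic Frobenioids `C_{K/F}` of Example 6.3 / Theorem 6.4 (i) [cite: MochizukiFrdI2008, Thm. 6.4 (i) p.114]
and the `p`-adic Frobenioids of Mochizuki, *The geometry of Frobenioids II*, Example 1.1 / Theorem 1.2 (i)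
[cite: MochizukiFrdII2008, Ex 1.1 (i) p.7] [cite: MochizukiFrdII2008, Thm 1.2 (i) p.9].

PROOF-ONLY file (abc-iut cell, D-0079 L-F [FrdI/II] sub-cell, LF-FRD row F-2657 `FrdI.T49.RightEqLeftAt`; seat
abc-iut-L1-t14, the lineage that typed `Thm49Sub.lean`), 0 definitions. The predicate
`RightEqLeftAt F₁ F₂ Ψ A 𝔭 𝔭'` (ONE isomorphism of monoids `Φ₁(A)_𝔭 ≃* Φ₂(Ψ A)_𝔭'` computing `Div(Ψ φ)` for the
co-angular pre-steps out of `A` and `(Ψψ)_* Div(Ψ ψ)` for those into `A`) is a schema over its binders; its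
universal closure is false (`FrdI.T49.not_forall_rightEqLeftAt`, seat abc-iut-f-012: a free second structure
functor), and the only instance forms in the tree were `rightEqLeftAt_refl` (`Ψ = 𝟭`) and the reductions
`rightEqLeftAt_of_mulEquiv` / `rightEqLeftAt_of_cover`. This file supplies the instance print asserts:

* `rightEqLeftAt_of_divisorMonoidIsoOver` — an isomorphism of functors `Ψ^Φ : Φ₁ ⥲ Φ₂` over `Ψ` (the CONCLUSION
  of Thm. 4.9, `DivisorMonoidIsoOver`) which computes `Div(Ψ φ) = Ψ^Φ_A(Div φ)` on pre-steps restricts, at every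
  pair of primes `(𝔭, 𝔭')` corresponding as in Thm. 4.2 (ii) (a), to a witness of `RightEqLeftAt` (the left-hand
  property being the naturality of `Ψ^Φ` with respect to pull-backs);
* `exists_primesEquiv_forall_rightEqLeftAt_of_isOfFSMType` — for every pair of Frobenioids over bases of
  FSM-type with `Φ_i` perf-factorial, `C₁` rational at THE birationalization and the `Thm42Setting` (isotropic,
  standard, not group-like), and EVERY equivalence `Ψ`: THE `Ψ^Prime` of Thm. 4.2 (ii) (a family of bijections of
  primes characterised by clauses (a), (b)) exists and `RightEqLeftAt F₁ F₂ Ψ A 𝔭 (Ψ^Prime 𝔭)` holds at EVERY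
  object `A` and EVERY prime `𝔭` — from the cell's Thm. 4.9 closers with compatibility clause
  (`FrdI.T49.exists_thm49_compat_ofFunctor_of_isOfFSMType'`, seats abc-iut-w4-d105/d109);
* the same HYPOTHESIS-FREE at `C_{K₁/F₁} ⥲ C_{K₂/F₂}` (`rightEqLeftAt_arith`,
  `exists_primesEquiv_forall_rightEqLeftAt_arith`; inputs = Thm. 6.4 (i) as proved in the tree), at the `p`-adic
  Frobenioids over bases of FSM-type (`…_padic`) and with NO input at THE `C₀(p₁) ⥲ C₀(p₂)` (`…_czeroGal`).

No statement of either paper is restated or strengthened; nothing here bears on, or takes a side on,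
[IUTchIII] Cor. 3.12.
-/

noncomputable section

namespace Literature.AlgebraicGeometry.Frobenioids

open CategoryTheory Opposite
open PreFrobenioid PreFrobenioidData

universe w v v' u u'

namespace FrdI.T49

/-! ### From an isomorphism of functors `Ψ^Φ` over `Ψ` computing divisors of pre-steps -/

section General

variable {D₁ : Type u} [Category.{v} D₁] {Φ₁ : D₁ᵒᵖ ⥤ CommMonCat.{w}} {C₁ : Type u'} [Category.{v'} C₁]
  {D₂ : Type u} [Category.{v} D₂] {Φ₂ : D₂ᵒᵖ ⥤ CommMonCat.{w}} {C₂ : Type u'} [Category.{v'} C₂]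
  {F₁ : C₁ ⥤ ElemFrobenioid Φ₁} {F₂ : C₂ ⥤ ElemFrobenioid Φ₂}

/-- **`Ψ^Φ` ⇒ "right = left" at the corresponding primes.** In a Frobenioid `C₁`, an isomorphism of functors
`Ψ^Φ : Φ₁ ⥲ Φ₂` lying over `Ψ` (monoid isomorphisms `Φ₁(A) ≃* Φ₂(Ψ A)` natural with respect to pull-backs — the
conclusion of Thm. 4.9) which computes `Div(Ψ φ) = Ψ^Φ_A(Div φ)` on pre-steps restricts, for every pair of primes
`𝔭 ↦ 𝔭'` corresponding on the co-angular pre-steps out of `A` (Thm. 4.2 (ii), clause (a)), to ONE isomorphism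
`Φ₁(A)_𝔭 ≃* Φ₂(Ψ A)_𝔭'` with both the right-hand and the left-hand property of Thm. 4.2 (iii).
[cite: MochizukiFrdI2008, Thm. 4.9 p.89] -/
theorem rightEqLeftAt_of_divisorMonoidIsoOver {Ψ : C₁ ≌ C₂} (hF₁ : PreFrobenioid.IsFrobenioid F₁)
    (E : DivisorMonoidIsoOver (ofFunctor Φ₁ F₁) (ofFunctor Φ₂ F₂) Ψ)
    (hE : ∀ ⦃A B : C₁⦄ (φ : A ⟶ B), PreFrobenioid.IsPreStep F₁ φ →
      E.iso A (PreFrobenioid.Div F₁ φ) = PreFrobenioid.Div F₂ (Ψ.functor.map φ))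
    (A : C₁) (𝔭 : Primes (Φ₁.obj (op (PreFrobenioid.baseObj F₁ A))))
    (𝔭' : Primes (Φ₂.obj (op (PreFrobenioid.baseObj F₂ (Ψ.functor.obj A)))))
    (ha : ∀ ⦃B : C₁⦄ (φ : A ⟶ B), PreFrobenioid.IsCoAngularPreStep F₁ φ →
      (PreFrobenioid.Div F₁ φ ∈ 𝔭.submonoid ↔ PreFrobenioid.Div F₂ (Ψ.functor.map φ) ∈ 𝔭'.submonoid)) :
    RightEqLeftAt F₁ F₂ Ψ A 𝔭 𝔭' :=
  rightEqLeftAt_of_mulEquiv hF₁ (E.iso A) (fun _ φ hφ => hE φ hφ)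
    (fun B ψ hψ y hy => (E.natural ψ y).symm.trans (by
      change E.iso B (pull Φ₁ (PreFrobenioid.Base F₁ ψ) y) = _
      rw [hy]
      exact hE ψ hψ))
    𝔭 𝔭' ha

/-! ### Every pair of Frobenioids over bases of FSM-type, every equivalence `Ψ`: at THE `Ψ^Prime` -/

/-- **"The right-hand and left-hand isomorphisms of Theorem 4.2, (iii), coincide" — at every object and every
prime, for THE `Ψ^Prime`.** For Frobenioids `C_i → F_{Φ_i}` over bases of FSM-type with `Φ_i` perf-factorial,
`C₁` rational at THE birationalization (Def. 4.5 (ii)/(iii)) and `C_i` isotropic, standard, not group-like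
(`Thm42Setting`), and every equivalence `Ψ : C₁ ⥲ C₂`: there is a family of bijections
`e_A : Prime(Φ₁(A)) ≃ Prime(Φ₂(Ψ A))` with the characteristic clauses (a), (b) of Thm. 4.2 (ii) (THE `Ψ^Prime`)
such that `RightEqLeftAt F₁ F₂ Ψ A 𝔭 (e_A 𝔭)` holds for every `A` and every `𝔭` — obtained from the `Ψ^Φ` of
Thm. 4.9 with its divisor clause. [cite: MochizukiFrdI2008, Thm. 4.9 p.89] -/
theorem exists_primesEquiv_forall_rightEqLeftAt_of_isOfFSMType (hF₁ : PreFrobenioid.IsFrobenioid F₁)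
    (hF₂ : PreFrobenioid.IsFrobenioid F₂) (hD₁ : IsOfFSMType D₁) (hD₂ : IsOfFSMType D₂)
    (hpf₁ : Objectwise (fun M _ => IsPerfFactorial M) Φ₁) (hpf₂ : Objectwise (fun M _ => IsPerfFactorial M) Φ₂)
    (hrat₁ : ∀ A : C₁, PreFrobenioidData.IsRational
      (PreFrobenioid.biratData hF₁ (PreFrobenioid.hasBiratSquares_of_isFrobenioid hF₁))
      (S := ofFunctor Φ₁ F₁) (fun a 𝔭 => PrimarySupp a 𝔭) A)
    (Ψ : C₁ ≌ C₂) (hT : Thm42Setting (ofFunctor Φ₁ F₁) (ofFunctor Φ₂ F₂)) :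
    ∃ e : ∀ A : C₁, Primes (Φ₁.obj (op (PreFrobenioid.baseObj F₁ A))) ≃
        Primes (Φ₂.obj (op (PreFrobenioid.baseObj F₂ (Ψ.functor.obj A)))),
      (∀ (A : C₁) (𝔭 : Primes (Φ₁.obj (op (PreFrobenioid.baseObj F₁ A)))),
        (∀ ⦃B : C₁⦄ (φ : A ⟶ B), PreFrobenioid.IsCoAngularPreStep F₁ φ →
            (PreFrobenioid.Div F₁ φ ∈ 𝔭.submonoid ↔
              PreFrobenioid.Div F₂ (Ψ.functor.map φ) ∈ (e A 𝔭).submonoid)) ∧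
        ∀ ⦃B : C₁⦄ (ψ : B ⟶ A), PreFrobenioid.IsCoAngularPreStep F₁ ψ →
          ((∃ y ∈ 𝔭.submonoid, pull Φ₁ (PreFrobenioid.Base F₁ ψ) y = PreFrobenioid.Div F₁ ψ) ↔
            ∃ y ∈ (e A 𝔭).submonoid,
              pull Φ₂ (PreFrobenioid.Base F₂ (Ψ.functor.map ψ)) y = PreFrobenioid.Div F₂ (Ψ.functor.map ψ))) ∧
      ∀ (A : C₁) (𝔭 : Primes (Φ₁.obj (op (PreFrobenioid.baseObj F₁ A)))), RightEqLeftAt F₁ F₂ Ψ A 𝔭 (e A 𝔭) := by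
  obtain ⟨E, e, he, hE, -⟩ :=
    exists_thm49_compat_ofFunctor_of_isOfFSMType' hF₁ hF₂ hD₁ hD₂ hpf₁ hpf₂ hrat₁ Ψ hT
  have ha : ∀ (A : C₁) (𝔭 : Primes (Φ₁.obj (op (PreFrobenioid.baseObj F₁ A)))) ⦃B : C₁⦄ (φ : A ⟶ B),
      PreFrobenioid.IsCoAngularPreStep F₁ φ →
        (PreFrobenioid.Div F₁ φ ∈ 𝔭.submonoid ↔
          PreFrobenioid.Div F₂ (Ψ.functor.map φ) ∈ (e A 𝔭).submonoid) :=
    fun A 𝔭 B φ hφ => (he A 𝔭).1 φ ((ofFunctor_isCoAngularPreStep F₁ φ).mpr hφ)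
  refine ⟨e, fun A 𝔭 => ⟨ha A 𝔭, fun B ψ hψ => ?_⟩, fun A 𝔭 =>
    rightEqLeftAt_of_divisorMonoidIsoOver hF₁ E hE A 𝔭 (e A 𝔭) (ha A 𝔭)⟩
  exact (he A 𝔭).2 ψ ((ofFunctor_isCoAngularPreStep F₁ ψ).mpr hψ)

/-- **`RightEqLeftAt` at every pair of `Ψ^Prime`-corresponding primes** (hypothesis form of the preceding: the
primes `𝔭`, `𝔭'` correspond on the co-angular pre-steps out of `A`, Thm. 4.2 (ii) (a) — which pins `𝔭'` down
as `Ψ^Prime(𝔭)`), for Frobenioids over bases of FSM-type as above. [cite: MochizukiFrdI2008, Thm. 4.9 p.89] -/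
theorem rightEqLeftAt_of_isOfFSMType (hF₁ : PreFrobenioid.IsFrobenioid F₁)
    (hF₂ : PreFrobenioid.IsFrobenioid F₂) (hD₁ : IsOfFSMType D₁) (hD₂ : IsOfFSMType D₂)
    (hpf₁ : Objectwise (fun M _ => IsPerfFactorial M) Φ₁) (hpf₂ : Objectwise (fun M _ => IsPerfFactorial M) Φ₂)
    (hrat₁ : ∀ A : C₁, PreFrobenioidData.IsRational
      (PreFrobenioid.biratData hF₁ (PreFrobenioid.hasBiratSquares_of_isFrobenioid hF₁))
      (S := ofFunctor Φ₁ F₁) (fun a 𝔭 => PrimarySupp a 𝔭) A)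
    (Ψ : C₁ ≌ C₂) (hT : Thm42Setting (ofFunctor Φ₁ F₁) (ofFunctor Φ₂ F₂))
    (A : C₁) (𝔭 : Primes (Φ₁.obj (op (PreFrobenioid.baseObj F₁ A))))
    (𝔭' : Primes (Φ₂.obj (op (PreFrobenioid.baseObj F₂ (Ψ.functor.obj A)))))
    (ha : ∀ ⦃B : C₁⦄ (φ : A ⟶ B), PreFrobenioid.IsCoAngularPreStep F₁ φ →
      (PreFrobenioid.Div F₁ φ ∈ 𝔭.submonoid ↔ PreFrobenioid.Div F₂ (Ψ.functor.map φ) ∈ 𝔭'.submonoid)) :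
    RightEqLeftAt F₁ F₂ Ψ A 𝔭 𝔭' := by
  obtain ⟨E, _, _, hE, -⟩ :=
    exists_thm49_compat_ofFunctor_of_isOfFSMType' hF₁ hF₂ hD₁ hD₂ hpf₁ hpf₂ hrat₁ Ψ hT
  exact rightEqLeftAt_of_divisorMonoidIsoOver hF₁ E hE A 𝔭 𝔭' ha

end General

/-! ### At the arithmetic Frobenioids `C_{K/F}` of [FrdI] Example 6.3 — nothing assumed -/

section Arith

variable (F₁ : Type) [Field F₁] [NumberField F₁] (K₁ : Type) [Field K₁] [Algebra F₁ K₁] [IsGalois F₁ K₁]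
variable (F₂ : Type) [Field F₂] [NumberField F₂] (K₂ : Type) [Field K₂] [Algebra F₂ K₂] [IsGalois F₂ K₂]

/-- **"Right = left" at `C_{K₁/F₁} ⥲ C_{K₂/F₂}`, hypothesis-free**: for EVERY equivalence `Ψ` between arithmetic
Frobenioids of Galois extensions of number fields, THE `Ψ^Prime` (bijections of primes with clauses (a), (b) of
Thm. 4.2 (ii)) exists and `RightEqLeftAt` holds at every object and every prime — every input (Frobenioid, bases
`B(Gal(K_i/F_i))⁰` of FSM-type, `Φ` perf-factorial, rationally standard / isotropic / not group-like = Thm. 6.4 (i))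
being a theorem of the tree. [cite: MochizukiFrdI2008, Thm. 4.9 p.89] [cite: MochizukiFrdI2008, Thm. 6.4 (i) p.114] -/
theorem exists_primesEquiv_forall_rightEqLeftAt_arith (Ψ : arithFrobenioid F₁ K₁ ≌ arithFrobenioid F₂ K₂) :
    ∃ e : ∀ A : arithFrobenioid F₁ K₁,
        Primes ((arithFrobenioidOps F₁ K₁).Mon ((arithFrobenioidOps F₁ K₁).base.obj A)) ≃
          Primes ((arithFrobenioidOps F₂ K₂).Mon ((arithFrobenioidOps F₂ K₂).base.obj (Ψ.functor.obj A))),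
      (∀ (A : arithFrobenioid F₁ K₁)
          (𝔭 : Primes ((arithFrobenioidOps F₁ K₁).Mon ((arithFrobenioidOps F₁ K₁).base.obj A))),
        (∀ ⦃B : arithFrobenioid F₁ K₁⦄ (φ : A ⟶ B),
            PreFrobenioid.IsCoAngularPreStep
                (ModelFrobenioid.toElem (arithDivisorFunctor F₁ K₁) (unitsFunctor F₁ K₁) (divNatTrans F₁ K₁)) φ →
              ((arithFrobenioidOps F₁ K₁).div φ ∈ 𝔭.submonoid ↔
                (arithFrobenioidOps F₂ K₂).div (Ψ.functor.map φ) ∈ (e A 𝔭).submonoid)) ∧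
        ∀ ⦃B : arithFrobenioid F₁ K₁⦄ (ψ : B ⟶ A),
          PreFrobenioid.IsCoAngularPreStep
              (ModelFrobenioid.toElem (arithDivisorFunctor F₁ K₁) (unitsFunctor F₁ K₁) (divNatTrans F₁ K₁)) ψ →
            ((∃ y ∈ 𝔭.submonoid,
                (arithFrobenioidOps F₁ K₁).pull ((arithFrobenioidOps F₁ K₁).base.map ψ) y =
                  (arithFrobenioidOps F₁ K₁).div ψ) ↔
              ∃ y ∈ (e A 𝔭).submonoid,
                (arithFrobenioidOps F₂ K₂).pull ((arithFrobenioidOps F₂ K₂).base.map (Ψ.functor.map ψ)) y =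
                  (arithFrobenioidOps F₂ K₂).div (Ψ.functor.map ψ))) ∧
      ∀ (A : arithFrobenioid F₁ K₁)
        (𝔭 : Primes ((arithFrobenioidOps F₁ K₁).Mon ((arithFrobenioidOps F₁ K₁).base.obj A))),
        RightEqLeftAt (ModelFrobenioid.toElem (arithDivisorFunctor F₁ K₁) (unitsFunctor F₁ K₁) (divNatTrans F₁ K₁))
          (ModelFrobenioid.toElem (arithDivisorFunctor F₂ K₂) (unitsFunctor F₂ K₂) (divNatTrans F₂ K₂)) Ψ A 𝔭
          (e A 𝔭) :=
  exists_primesEquiv_forall_rightEqLeftAt_of_isOfFSMType (arithFrobenioid_isFrobenioid F₁ K₁)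
    (arithFrobenioid_isFrobenioid F₂ K₂) (FinSubextCat.isOfFSMType F₁ K₁) (FinSubextCat.isOfFSMType F₂ K₂)
    (arith_objectwise_isPerfFactorial F₁ K₁) (arith_objectwise_isPerfFactorial F₂ K₂)
    (arith_isRational_biratData F₁ K₁) Ψ (thm42Setting_arith F₁ K₁ F₂ K₂)

/-- **`RightEqLeftAt` at `C_{K₁/F₁} ⥲ C_{K₂/F₂}` for every pair of `Ψ^Prime`-corresponding primes**, hypothesis-free
beyond the correspondence clause (a) of Thm. 4.2 (ii) that names `𝔭'`. [cite: MochizukiFrdI2008, Thm. 4.9 p.89] -/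
theorem rightEqLeftAt_arith (Ψ : arithFrobenioid F₁ K₁ ≌ arithFrobenioid F₂ K₂) (A : arithFrobenioid F₁ K₁)
    (𝔭 : Primes ((arithFrobenioidOps F₁ K₁).Mon ((arithFrobenioidOps F₁ K₁).base.obj A)))
    (𝔭' : Primes ((arithFrobenioidOps F₂ K₂).Mon ((arithFrobenioidOps F₂ K₂).base.obj (Ψ.functor.obj A))))
    (ha : ∀ ⦃B : arithFrobenioid F₁ K₁⦄ (φ : A ⟶ B),
      PreFrobenioid.IsCoAngularPreStep
          (ModelFrobenioid.toElem (arithDivisorFunctor F₁ K₁) (unitsFunctor F₁ K₁) (divNatTrans F₁ K₁)) φ →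
        ((arithFrobenioidOps F₁ K₁).div φ ∈ 𝔭.submonoid ↔
          (arithFrobenioidOps F₂ K₂).div (Ψ.functor.map φ) ∈ 𝔭'.submonoid)) :
    RightEqLeftAt (ModelFrobenioid.toElem (arithDivisorFunctor F₁ K₁) (unitsFunctor F₁ K₁) (divNatTrans F₁ K₁))
      (ModelFrobenioid.toElem (arithDivisorFunctor F₂ K₂) (unitsFunctor F₂ K₂) (divNatTrans F₂ K₂)) Ψ A 𝔭 𝔭' :=
  rightEqLeftAt_of_isOfFSMType (arithFrobenioid_isFrobenioid F₁ K₁) (arithFrobenioid_isFrobenioid F₂ K₂)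
    (FinSubextCat.isOfFSMType F₁ K₁) (FinSubextCat.isOfFSMType F₂ K₂) (arith_objectwise_isPerfFactorial F₁ K₁)
    (arith_objectwise_isPerfFactorial F₂ K₂) (arith_isRational_biratData F₁ K₁) Ψ
    (thm42Setting_arith F₁ K₁ F₂ K₂) A 𝔭 𝔭' ha

end Arith

end FrdI.T49

/-! ### At the `p`-adic Frobenioids of [FrdII] Example 1.1 -/

namespace PadicFrd

section TwoData

variable {D₁ : Type u} [Category.{v} D₁] {D₂ : Type u} [Category.{v} D₂]
variable {p₁ p₂ : ℕ} [Fact p₁.Prime] [Fact p₂.Prime]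
variable (d₁ : Datum D₁ p₁) (d₂ : Datum D₂ p₂)

/-- **"Right = left" at a pair of `p`-adic Frobenioids over bases of FSM-type and every `Ψ : C₁ ⥲ C₂`**: THE
`Ψ^Prime` exists and `FrdI.T49.RightEqLeftAt` holds at every object and every prime — the inputs being [FrdII]
Thm. 1.2 (i) as proved in the tree. [cite: MochizukiFrdI2008, Thm. 4.9 p.89] [cite: MochizukiFrdII2008, Thm 1.2 (i) p.9] -/
theorem exists_primesEquiv_forall_rightEqLeftAt_padic (hD₁ : IsOfFSMType D₁) (hD₂ : IsOfFSMType D₂)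
    (Ψ : d₁.frobenioid ≌ d₂.frobenioid) :
    ∃ e : ∀ A : d₁.frobenioid,
        Primes ((ModelFrobenioid.data d₁.Φ d₁.B d₁.divB).Mon ((ModelFrobenioid.data d₁.Φ d₁.B d₁.divB).base.obj A)) ≃
          Primes ((ModelFrobenioid.data d₂.Φ d₂.B d₂.divB).Mon
            ((ModelFrobenioid.data d₂.Φ d₂.B d₂.divB).base.obj (Ψ.functor.obj A))),
      (∀ (A : d₁.frobenioid)
          (𝔭 : Primes ((ModelFrobenioid.data d₁.Φ d₁.B d₁.divB).Mon
            ((ModelFrobenioid.data d₁.Φ d₁.B d₁.divB).base.obj A))),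
        (∀ ⦃B : d₁.frobenioid⦄ (φ : A ⟶ B), PreFrobenioid.IsCoAngularPreStep d₁.structureFunctor φ →
            ((ModelFrobenioid.data d₁.Φ d₁.B d₁.divB).div φ ∈ 𝔭.submonoid ↔
              (ModelFrobenioid.data d₂.Φ d₂.B d₂.divB).div (Ψ.functor.map φ) ∈ (e A 𝔭).submonoid)) ∧
        ∀ ⦃B : d₁.frobenioid⦄ (ψ : B ⟶ A), PreFrobenioid.IsCoAngularPreStep d₁.structureFunctor ψ →
          ((∃ y ∈ 𝔭.submonoid,
              (ModelFrobenioid.data d₁.Φ d₁.B d₁.divB).pull ((ModelFrobenioid.data d₁.Φ d₁.B d₁.divB).base.map ψ) y =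
                (ModelFrobenioid.data d₁.Φ d₁.B d₁.divB).div ψ) ↔
            ∃ y ∈ (e A 𝔭).submonoid,
              (ModelFrobenioid.data d₂.Φ d₂.B d₂.divB).pull
                  ((ModelFrobenioid.data d₂.Φ d₂.B d₂.divB).base.map (Ψ.functor.map ψ)) y =
                (ModelFrobenioid.data d₂.Φ d₂.B d₂.divB).div (Ψ.functor.map ψ))) ∧
      ∀ (A : d₁.frobenioid)
        (𝔭 : Primes ((ModelFrobenioid.data d₁.Φ d₁.B d₁.divB).Mon
          ((ModelFrobenioid.data d₁.Φ d₁.B d₁.divB).base.obj A))),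
        FrdI.T49.RightEqLeftAt d₁.structureFunctor d₂.structureFunctor Ψ A 𝔭 (e A 𝔭) :=
  FrdI.T49.exists_primesEquiv_forall_rightEqLeftAt_of_isOfFSMType
    (d₁.isFrobenioid_of_isMonoidData (d₁.isMonoidData_of_isOfFSMType hD₁))
    (d₂.isFrobenioid_of_isMonoidData (d₂.isMonoidData_of_isOfFSMType hD₂)) hD₁ hD₂
    (padic_objectwise_isPerfFactorial d₁) (padic_objectwise_isPerfFactorial d₂)
    (padic_isRational_biratData d₁ hD₁) Ψ (thm42Setting_padic d₁ d₂ hD₁ hD₂)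

/-- **`FrdI.T49.RightEqLeftAt` at a pair of `p`-adic Frobenioids over bases of FSM-type, for every pair of
`Ψ^Prime`-corresponding primes.** [cite: MochizukiFrdI2008, Thm. 4.9 p.89] [cite: MochizukiFrdII2008, Thm 1.2 (i) p.9] -/
theorem rightEqLeftAt_padic (hD₁ : IsOfFSMType D₁) (hD₂ : IsOfFSMType D₂) (Ψ : d₁.frobenioid ≌ d₂.frobenioid)
    (A : d₁.frobenioid)
    (𝔭 : Primes ((ModelFrobenioid.data d₁.Φ d₁.B d₁.divB).Mon ((ModelFrobenioid.data d₁.Φ d₁.B d₁.divB).base.obj A)))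
    (𝔭' : Primes ((ModelFrobenioid.data d₂.Φ d₂.B d₂.divB).Mon
      ((ModelFrobenioid.data d₂.Φ d₂.B d₂.divB).base.obj (Ψ.functor.obj A))))
    (ha : ∀ ⦃B : d₁.frobenioid⦄ (φ : A ⟶ B), PreFrobenioid.IsCoAngularPreStep d₁.structureFunctor φ →
      ((ModelFrobenioid.data d₁.Φ d₁.B d₁.divB).div φ ∈ 𝔭.submonoid ↔
        (ModelFrobenioid.data d₂.Φ d₂.B d₂.divB).div (Ψ.functor.map φ) ∈ 𝔭'.submonoid)) :
    FrdI.T49.RightEqLeftAt d₁.structureFunctor d₂.structureFunctor Ψ A 𝔭 𝔭' :=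
  FrdI.T49.rightEqLeftAt_of_isOfFSMType
    (d₁.isFrobenioid_of_isMonoidData (d₁.isMonoidData_of_isOfFSMType hD₁))
    (d₂.isFrobenioid_of_isMonoidData (d₂.isMonoidData_of_isOfFSMType hD₂)) hD₁ hD₂
    (padic_objectwise_isPerfFactorial d₁) (padic_objectwise_isPerfFactorial d₂)
    (padic_isRational_biratData d₁ hD₁) Ψ (thm42Setting_padic d₁ d₂ hD₁ hD₂) A 𝔭 𝔭' ha

end TwoData

/-! ### At THE `C₀(p₁) ⥲ C₀(p₂)` of [FrdII] Example 1.1 (i): nothing assumed -/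

section CZero

variable (p₁ p₂ : ℕ) [Fact p₁.Prime] [Fact p₂.Prime]

/-- **"Right = left" at THE `p`-adic Frobenioids `C₀(p₁) ⥲ C₀(p₂)`, with NO hypothesis**: for every equivalence
`Ψ`, THE `Ψ^Prime` exists and `FrdI.T49.RightEqLeftAt` holds at every object and every prime (`D₀` of FSM-type,
`PadicFrd.dZero_isOfFSMType`). [cite: MochizukiFrdI2008, Thm. 4.9 p.89] [cite: MochizukiFrdII2008, Ex 1.1 (i) p.7] -/
theorem exists_primesEquiv_forall_rightEqLeftAt_czeroGal (Ψ : CZeroGal p₁ ≌ CZeroGal p₂) :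
    ∃ e : ∀ A : CZeroGal p₁,
        Primes ((ModelFrobenioid.data (Datum.zeroGal p₁).Φ (Datum.zeroGal p₁).B (Datum.zeroGal p₁).divB).Mon
            ((ModelFrobenioid.data (Datum.zeroGal p₁).Φ (Datum.zeroGal p₁).B (Datum.zeroGal p₁).divB).base.obj A)) ≃
          Primes ((ModelFrobenioid.data (Datum.zeroGal p₂).Φ (Datum.zeroGal p₂).B (Datum.zeroGal p₂).divB).Mon
            ((ModelFrobenioid.data (Datum.zeroGal p₂).Φ (Datum.zeroGal p₂).B (Datum.zeroGal p₂).divB).base.obj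
              (Ψ.functor.obj A))),
      (∀ (A : CZeroGal p₁)
          (𝔭 : Primes ((ModelFrobenioid.data (Datum.zeroGal p₁).Φ (Datum.zeroGal p₁).B (Datum.zeroGal p₁).divB).Mon
            ((ModelFrobenioid.data (Datum.zeroGal p₁).Φ (Datum.zeroGal p₁).B (Datum.zeroGal p₁).divB).base.obj A))),
        (∀ ⦃B : CZeroGal p₁⦄ (φ : A ⟶ B),
            PreFrobenioid.IsCoAngularPreStep (Datum.zeroGal p₁).structureFunctor φ →
              ((ModelFrobenioid.data (Datum.zeroGal p₁).Φ (Datum.zeroGal p₁).B (Datum.zeroGal p₁).divB).div φ ∈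
                  𝔭.submonoid ↔
                (ModelFrobenioid.data (Datum.zeroGal p₂).Φ (Datum.zeroGal p₂).B (Datum.zeroGal p₂).divB).div
                    (Ψ.functor.map φ) ∈ (e A 𝔭).submonoid)) ∧
        ∀ ⦃B : CZeroGal p₁⦄ (ψ : B ⟶ A),
          PreFrobenioid.IsCoAngularPreStep (Datum.zeroGal p₁).structureFunctor ψ →
            ((∃ y ∈ 𝔭.submonoid,
                (ModelFrobenioid.data (Datum.zeroGal p₁).Φ (Datum.zeroGal p₁).B (Datum.zeroGal p₁).divB).pull
                    ((ModelFrobenioid.data (Datum.zeroGal p₁).Φ (Datum.zeroGal p₁).B (Datum.zeroGal p₁).divB).base.map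
                      ψ) y =
                  (ModelFrobenioid.data (Datum.zeroGal p₁).Φ (Datum.zeroGal p₁).B (Datum.zeroGal p₁).divB).div ψ) ↔
              ∃ y ∈ (e A 𝔭).submonoid,
                (ModelFrobenioid.data (Datum.zeroGal p₂).Φ (Datum.zeroGal p₂).B (Datum.zeroGal p₂).divB).pull
                    ((ModelFrobenioid.data (Datum.zeroGal p₂).Φ (Datum.zeroGal p₂).B (Datum.zeroGal p₂).divB).base.map
                      (Ψ.functor.map ψ)) y =
                  (ModelFrobenioid.data (Datum.zeroGal p₂).Φ (Datum.zeroGal p₂).B (Datum.zeroGal p₂).divB).div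
                    (Ψ.functor.map ψ))) ∧
      ∀ (A : CZeroGal p₁)
        (𝔭 : Primes ((ModelFrobenioid.data (Datum.zeroGal p₁).Φ (Datum.zeroGal p₁).B (Datum.zeroGal p₁).divB).Mon
          ((ModelFrobenioid.data (Datum.zeroGal p₁).Φ (Datum.zeroGal p₁).B (Datum.zeroGal p₁).divB).base.obj A))),
        FrdI.T49.RightEqLeftAt (Datum.zeroGal p₁).structureFunctor (Datum.zeroGal p₂).structureFunctor Ψ A 𝔭
          (e A 𝔭) :=
  exists_primesEquiv_forall_rightEqLeftAt_padic (Datum.zeroGal p₁) (Datum.zeroGal p₂) (dZero_isOfFSMType p₁)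
    (dZero_isOfFSMType p₂) Ψ

/-- **`FrdI.T49.RightEqLeftAt` at THE `C₀(p₁) ⥲ C₀(p₂)` for every pair of `Ψ^Prime`-corresponding primes**, no
hypothesis beyond the correspondence clause. [cite: MochizukiFrdI2008, Thm. 4.9 p.89] [cite: MochizukiFrdII2008, Ex 1.1 (i) p.7] -/
theorem rightEqLeftAt_czeroGal (Ψ : CZeroGal p₁ ≌ CZeroGal p₂) (A : CZeroGal p₁)
    (𝔭 : Primes ((ModelFrobenioid.data (Datum.zeroGal p₁).Φ (Datum.zeroGal p₁).B (Datum.zeroGal p₁).divB).Mon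
      ((ModelFrobenioid.data (Datum.zeroGal p₁).Φ (Datum.zeroGal p₁).B (Datum.zeroGal p₁).divB).base.obj A)))
    (𝔭' : Primes ((ModelFrobenioid.data (Datum.zeroGal p₂).Φ (Datum.zeroGal p₂).B (Datum.zeroGal p₂).divB).Mon
      ((ModelFrobenioid.data (Datum.zeroGal p₂).Φ (Datum.zeroGal p₂).B (Datum.zeroGal p₂).divB).base.obj
        (Ψ.functor.obj A))))
    (ha : ∀ ⦃B : CZeroGal p₁⦄ (φ : A ⟶ B),
      PreFrobenioid.IsCoAngularPreStep (Datum.zeroGal p₁).structureFunctor φ →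
        ((ModelFrobenioid.data (Datum.zeroGal p₁).Φ (Datum.zeroGal p₁).B (Datum.zeroGal p₁).divB).div φ ∈
            𝔭.submonoid ↔
          (ModelFrobenioid.data (Datum.zeroGal p₂).Φ (Datum.zeroGal p₂).B (Datum.zeroGal p₂).divB).div
              (Ψ.functor.map φ) ∈ 𝔭'.submonoid)) :
    FrdI.T49.RightEqLeftAt (Datum.zeroGal p₁).structureFunctor (Datum.zeroGal p₂).structureFunctor Ψ A 𝔭 𝔭' :=
  rightEqLeftAt_padic (Datum.zeroGal p₁) (Datum.zeroGal p₂) (dZero_isOfFSMType p₁) (dZero_isOfFSMType p₂) Ψ A 𝔭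
    𝔭' ha

end CZero

end PadicFrd

end Literature.AlgebraicGeometry.Frobenioids

end
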